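import Summits.BirchSwinnertonDyer.BirchSwinnertonDyer.Theses.UniversalToricDescent
import Summits.BirchSwinnertonDyer.BirchSwinnertonDyer.Theorems.UniversalToricDescentToricTransportModThreeStubRatSqueeze
import Summits.BirchSwinnertonDyer.BirchSwinnertonDyer.Theorems.UniversalToricDescentRationalSplitIMCInclusionAtThreeOfWall
import Mathlib.RingTheory.Polynomial.Cyclotomic.Basic
import Mathlib.RingTheory.PowerSeries.Ideal
import Mathlib.RingTheory.Length
import HarnessLib

/-!
# NODE `mu_dominance_relative_teeth` — crux `AdditiveSplitIMCInclusionAtThree` (stmt-BirchSwinnertonDyer-20395, THE WALL, UTD)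
# crux-ideate STANDING COVER round 7 (unit cruxidea-stmt-BirchSwinnertonDyer-20395-1-g7), 2026-08-30

D-0171 NODE (EQUIV-type, two levels, `sorry` ONLY inside `stub_*`).

* LEVEL 1 — THE EXACT COMPLEMENT (kernel-checked BOTH ways): `wall_iff_ratwall_and_muDominance :`
  WALL ↔ RATWALL ∧ `MuDominanceAtThree`. Here RATWALL = route item 24207 `RationalSplitIMCInclusionAtThree` BY NAME
  (tag WEAKER, landed `rationalSplitIMCInclusionAtThree_of_wall`), and `MuDominanceAtThree` is the NEW Prop
  «at every wall frame, for a generator `g` of `Ch_Λ(X_(∅,0))·R₀⟦T⟧`: every power of `3` dividing `g` divides `L`»,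
  i.e. `μ(Ch X) ≤ μ(L_𝔭^{BDP})` — NOT `μ = 0` (tag WEAKER: `muDominance_of_wall`). It tolerates `μ(L) > 0`, needs no
  analytic `μ`-theorem (item 20456 `HsiehAnyLevelInput` stays aside), no twin (item 24737), and is literally the
  wall's surplus over the rational wall: the proof of `⇐` is 3-saturation in the UFD `R₀⟦T⟧` after splitting off the
  maximal power of the prime `C 3` from `g` (`WfDvdMonoid.max_power_factor`; landed `prime_C_three`,
  `dvd_of_dvd_prime_pow_mul`).
* LEVEL 2 — THE RELATIVE TOOTH DOOR (composition kernel-checked, pieces are stubs):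
  `muDominanceAtThree_of_teeth : IsTorsionOfFiniteToothQuot → ToothDominanceReadsMu → RelativeToothBoundAtThree →
  MuDominanceAtThree`. (c1) one finite tooth specialisation ⇒ `Λ`-torsion (pure algebra, = node
  `toothwise_kolyvagin_mu` c1 verbatim, ATTACKABLE); (d) `ToothDominanceReadsMu` (pure `Λ`-algebra, ATTACKABLE,
  M-sized): for f.g. torsion `M` with `Ch(M)·R₀⟦T⟧ = (g)`, if for every `n` and infinitely many cyclotomic teeth
  `𝔮_k = (Φ_{3^k}(1+T))` one has `n·ℓ_Λ(M/𝔮_k M) ≤ n·ℓ_{R₀⟦T⟧}(R₀⟦T⟧/(𝔮_k, L)) + φ(3^k)` then `μ(g) ≤ μ(L)` (both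
  sides are `μ·φ(3^k) + λ + O(1)`; divide by `φ(3^k)`); (RT) `RelativeToothBoundAtThree` — THE ARITHMETIC LEAF
  (UNDECIDED; idea card `Ideas/relative-tooth-dominance.md`): at infinitely many teeth the `Λ`-length of the
  `(∅,0)` Selmer specialisation is bounded by the `R₀⟦T⟧`-length of `R₀⟦T⟧/(𝔮_k, L)` (`= v_{π_k}(L(ζ_{3^k}-1))`)
  up to `o(φ(3^k))`. Its informal engine PAIRS, tooth by tooth, a lossless finite-level Kolyvagin bound over
  `O_k = Λ/𝔮_k` (Tamagawa terms fade at deep ring-class characters; no Galois error at 3 under surjectivity) with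
  the finite-order `p`-adic Waldspurger value at the SAME character, so the global index and every global constant
  cancel; what is left is a LOCAL cancellation at the additive prime (line card §RT3).

Nothing here is a theorem about elliptic curves beyond compositions of landed results; BSD is not advanced by this
file. References: [Washington1997] §7.1 Prop. 7.2, §13.2 Thm. 13.12 (μ, λ, distinguished polynomials, `Λ` a UFD);
[Howard2004HeegnerKolyvagin] §1.6, Thm. 2.2.10; [MazurRubin2004] §§4.4–5.2; [BertoliniDarmon1990] (finite-level
Kolyvagin over ring class fields); [CornutVatsal2005]; Liu–Zhang–Zhang 2018 (finite-order `p`-adic Waldspurger).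
-/

set_option linter.dupNamespace false
set_option autoImplicit false

noncomputable section

open scoped Classical

open Literature.NumberTheory.EllipticCurves
open Summit.BirchSwinnertonDyer.BirchSwinnertonDyer.Theses.UniversalToricDescent
  (RationalSplitIMCInclusionAtThree AdditiveSplitIMCInclusionAtThree)
open Summit.BirchSwinnertonDyer.BirchSwinnertonDyer.Cruxes.ToricTransportModThree.RatwallThinComb
  (dvd_of_dvd_prime_pow_mul prime_C_three)
open Summit.BirchSwinnertonDyer.BirchSwinnertonDyer.Theorems.UniversalToricDescentRationalSplitIMCInclusionAtThreeOfWall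
  (rationalSplitIMCInclusionAtThree_of_wall)
open Summit.BirchSwinnertonDyer.Rank1Residual.X11b

namespace Summit.BirchSwinnertonDyer.BirchSwinnertonDyer.Cruxes.AdditiveSplitIMCInclusionAtThree.MuDominanceRelativeTeeth

/-! ## §0 Kernel algebra in `R₀⟦T⟧` (no `sorry`) -/

/-- Every non-zero `g ∈ R₀⟦T⟧` splits off a MAXIMAL power of the prime `3`: `g = 3^μ·g₀` with `3 ∤ g₀`
(`R₀` is a DVR, so `R₀⟦T⟧` is a UFD; `WfDvdMonoid.max_power_factor`). This `μ` is the `μ`-invariant of `g`.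
[Washington1997 §7.1] -/
theorem exists_eq_C_three_pow_mul_not_dvd {g : UnrSeries 3} (hg : g ≠ 0) :
    ∃ (μ : ℕ) (g₀ : UnrSeries 3),
      ¬ (PowerSeries.C ((3 : ℕ) : unrIntegers 3) : UnrSeries 3) ∣ g₀ ∧
        g = (PowerSeries.C ((3 : ℕ) : unrIntegers 3)) ^ μ * g₀ := by
  haveI := Summit.BirchSwinnertonDyer.Rank1Residual.X2.HidaLimitAlgebra.isDiscreteValuationRing_unrIntegers (p := 3)
  exact WfDvdMonoid.max_power_factor hg prime_C_three.irreducible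

/-- **The 3-saturation kernel of the wall.** In the domain `R₀⟦T⟧`: if `g ∣ 3^k·L` (the RATIONAL wall at a frame,
`Ch·R₀⟦T⟧ = (g)`) and every power of `3` dividing `g` divides `L` (`μ`-DOMINANCE), then `g ∣ L`, i.e.
`(L) ⊆ (g)` (the INTEGRAL wall at that frame). Proof: `g = 0` forces `L = 0`; else `g = 3^μ g₀`, `3 ∤ g₀`,
`L = 3^μ L₀`, cancel `3^μ`, and `g₀ ∣ 3^k L₀` gives `g₀ ∣ L₀` since `3` is prime. [folklore; Washington1997 §7.1] -/
theorem span_le_span_of_dvd_pow_mul_of_muDominance {g L : UnrSeries 3} {k : ℕ}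
    (hk : g ∣ (PowerSeries.C ((3 : ℕ) : unrIntegers 3)) ^ k * L)
    (hμ : ∀ j : ℕ, (PowerSeries.C ((3 : ℕ) : unrIntegers 3)) ^ j ∣ g →
      (PowerSeries.C ((3 : ℕ) : unrIntegers 3)) ^ j ∣ L) :
    Ideal.span ({L} : Set (UnrSeries 3)) ≤ Ideal.span {g} := by
  refine Ideal.span_singleton_le_span_singleton.mpr ?_
  by_cases hg : g = 0
  · subst hg
    obtain ⟨c, hc⟩ := hk
    rw [zero_mul] at hc
    rcases mul_eq_zero.mp hc with h3 | hL
    · exact absurd (pow_eq_zero_iff'.mp h3).1 prime_C_three.ne_zero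
    · rw [hL]
  · obtain ⟨μ, g₀, hg₀, rfl⟩ := exists_eq_C_three_pow_mul_not_dvd hg
    obtain ⟨L₀, rfl⟩ := hμ μ (Dvd.intro g₀ rfl)
    refine mul_dvd_mul_left _ (dvd_of_dvd_prime_pow_mul prime_C_three hg₀ k ?_)
    have h' : (PowerSeries.C ((3 : ℕ) : unrIntegers 3)) ^ μ * g₀ ∣
        (PowerSeries.C ((3 : ℕ) : unrIntegers 3)) ^ μ * ((PowerSeries.C ((3 : ℕ) : unrIntegers 3)) ^ k * L₀) := by
      have e : (PowerSeries.C ((3 : ℕ) : unrIntegers 3)) ^ k * ((PowerSeries.C ((3 : ℕ) : unrIntegers 3)) ^ μ * L₀)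
          = (PowerSeries.C ((3 : ℕ) : unrIntegers 3)) ^ μ * ((PowerSeries.C ((3 : ℕ) : unrIntegers 3)) ^ k * L₀) := by
        ring
      rw [← e]; exact hk
    exact (mul_dvd_mul_iff_left (pow_ne_zero μ prime_C_three.ne_zero)).mp h'

/-- Converse of the kernel: an integral inclusion `(L) ⊆ (g)` gives `μ`-dominance trivially. [folklore] -/
theorem muDominance_of_span_le_span {g L : UnrSeries 3} (h : Ideal.span ({L} : Set (UnrSeries 3)) ≤ Ideal.span {g})
    (j : ℕ) (hj : (PowerSeries.C ((3 : ℕ) : unrIntegers 3)) ^ j ∣ g) :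
    (PowerSeries.C ((3 : ℕ) : unrIntegers 3)) ^ j ∣ L :=
  hj.trans (Ideal.span_singleton_le_span_singleton.mp h)

/-- `Ch_Λ(X)·R₀⟦T⟧` is principal for every `Λ`-module (tree `charIdeal_isPrincipal_holds`, `Ideal.map_span`).
[Washington1997 §13.2] -/
theorem exists_map_charIdeal_eq_span (M : Type) [AddCommGroup M] [Module (IwasawaAlgebra 3) M] :
    ∃ g : UnrSeries 3,
      (Module.charIdeal (IwasawaAlgebra 3) M).map (PowerSeries.map (Halves.toUnr 3)) = Ideal.span {g} := by
  obtain ⟨f, hf⟩ := (charIdeal_isPrincipal_holds 3 M).principal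
  refine ⟨PowerSeries.map (Halves.toUnr 3) f, ?_⟩
  have hf' : Module.charIdeal (IwasawaAlgebra 3) M = Ideal.span {f} := hf
  rw [hf', Ideal.map_span, Set.image_singleton]

/-! ## §1 The cyclotomic teeth -/

/-- The `k`-th CYCLOTOMIC TOOTH `𝔮_k = Φ_{3^k}(1+T) ∈ Λ = ℤ₃⟦T⟧` (degree `φ(3^k)`, `Λ/𝔮_k ≅ ℤ₃[ζ_{3^k}] = O_k`).
Same definition as node `toothwise_kolyvagin_mu`. [Washington1997 §7.1] -/
def tooth (k : ℕ) : IwasawaAlgebra 3 :=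
  (((Polynomial.cyclotomic (3 ^ k) ℤ_[3]).comp (Polynomial.X + 1) : Polynomial ℤ_[3]) : PowerSeries ℤ_[3])

/-- The tooth read in the receptacle `R₀⟦T⟧`. [Castella2018 §2.2] -/
def toothUnr (k : ℕ) : UnrSeries 3 :=
  PowerSeries.map (Halves.toUnr 3) (tooth k)

/-- The specialisation `M ⧸ 𝔮_k M` of a `Λ`-module at the `k`-th tooth. [folklore] -/
abbrev ToothQuot (M : Type) [AddCommGroup M] [Module (IwasawaAlgebra 3) M] (k : ℕ) : Type :=
  M ⧸ (Ideal.span {tooth k} • (⊤ : Submodule (IwasawaAlgebra 3) M))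

/-- The `R₀⟦T⟧`-length of `R₀⟦T⟧/(𝔮_k, L)` = `v_{π_k}(L(ζ_{3^k} - 1))` (`⊤` iff `𝔮_k ∣ L`): the analytic side read at
the tooth WITHOUT an evaluation map. [Washington1997 §7.1] -/
abbrev toothLengthOf (L : UnrSeries 3) (k : ℕ) : ℕ∞ :=
  Module.length (UnrSeries 3) (UnrSeries 3 ⧸ Ideal.span ({toothUnr k, L} : Set (UnrSeries 3)))

/-! ## §2 Pieces (Props) -/

/-- PIECE A = LEVEL-1 SURPLUS (tag WEAKER than the crux: `muDominance_of_wall`; jointly with RATWALL EQUIVALENT to it: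
`wall_iff_ratwall_and_muDominance`). `μ`-DOMINANCE at additive split 3: at every wall frame (binders = the wall's,
verbatim) and every generator `g` of `Ch_Λ(X_(∅,0)(E/K_∞))·R₀⟦T⟧`, each power of `3` dividing `g` divides the BDP
branch `L`: `μ(Ch X) ≤ μ(L)`. NOT `μ = 0`; tolerates `μ(L) > 0`; vacuous off the torsion locus exactly like the
wall (`Ch = ⊤`, `g` a unit). [Howard2004HeegnerKolyvagin Thm. 2.2.10 shape; Washington1997 §13.2] -/
def MuDominanceAtThree : Prop :=
  ∀ (W : WeierstrassCurve ℚ) [W.IsElliptic] [W.IsGloballyMinimal] (N : ℕ) [NeZero N] (K : Type) [Field K]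
    [NumberField K] (Dt : Literature.NumberTheory.EllipticCurves.ModularForms.ModularParametrizationData W N),
    Summit.BirchSwinnertonDyer.Rank1Residual.Additive.ClassO6 W 3 → W.HasSurjectiveModNGaloisRep 3 →
    W.analyticRank = 1 → W.conductorNorm ℤ = N → IsImaginaryQuadratic K → SatisfiesHeegnerHypothesis N K →
    ∀ (κ : ZpExtension K 3), κ.IsAnticyclotomic →
    ∀ (γ : Field.absoluteGaloisGroup K) [Fact (κ.IsTopGenerator γ)]
      (𝔭 : IsDedekindDomain.HeightOneSpectrum (NumberField.RingOfIntegers K)),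
      ((3 : ℕ) : NumberField.RingOfIntegers K) ∈ 𝔭.asIdeal →
      𝔭.asIdeal.ramificationIdx (NumberField.RingOfIntegers ℚ) = 1 →
      𝔭.asIdeal.inertiaDeg (NumberField.RingOfIntegers ℚ) = 1 →
      ∀ (𝔭' : IsDedekindDomain.HeightOneSpectrum (NumberField.RingOfIntegers K)),
        ((3 : ℕ) : NumberField.RingOfIntegers K) ∈ 𝔭'.asIdeal → 𝔭' ≠ 𝔭 →
        ∀ (ι' : PadicAlgCl 3 ≃+* ℂ),
          Summit.BirchSwinnertonDyer.BirchSwinnertonDyer.Theorems.SchneiderFree.BranchInducesPrime 3 ι' 𝔭 →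
          ∀ (ΩK : ℂ) (Ωp : ℂ_[3]) (L : UnrSeries 3), ΩK ≠ 0 → Ωp ≠ 0 →
            IsBDPLFunction ι' 𝔭 κ γ Dt.f ΩK Ωp L →
            ∀ g : UnrSeries 3,
              (AcSelmer.XAc.charIdeal (W.baseChange K) 3 κ 𝔭' ∅ γ).map (PowerSeries.map (Halves.toUnr 3)) =
                  Ideal.span {g} →
              ∀ j : ℕ, (PowerSeries.C ((3 : ℕ) : unrIntegers 3)) ^ j ∣ g →
                (PowerSeries.C ((3 : ℕ) : unrIntegers 3)) ^ j ∣ L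

/-- PIECE c1 (ATTACKABLE, pure `Λ`-algebra, S-sized; verbatim the piece c1 of node `toothwise_kolyvagin_mu`): a finitely
generated `Λ`-module with ONE finite tooth specialisation is `Λ`-torsion. [Washington1997 §13.2] -/
def IsTorsionOfFiniteToothQuot : Prop :=
  ∀ (M : Type) [AddCommGroup M] [Module (IwasawaAlgebra 3) M] [Module.Finite (IwasawaAlgebra 3) M],
    (∃ k : ℕ, Finite (ToothQuot M k)) → Module.IsTorsion (IwasawaAlgebra 3) M

/-- PIECE d (ATTACKABLE, pure `Λ`-algebra, M-sized): THE TEETH READ `μ`-DOMINANCE. For a f.g. torsion `Λ`-module `M`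
with `Ch(M)·R₀⟦T⟧ = (g)` and any `L ∈ R₀⟦T⟧`: if for every `n` and infinitely many `k`,
`n·ℓ_Λ(M/𝔮_k M) ≤ n·ℓ(R₀⟦T⟧/(𝔮_k,L)) + φ(3^k)` (in `ℕ∞`), then every power of `3` dividing `g` divides `L`.
Reason: for `k ≫ 0`, `ℓ_Λ(M/𝔮_k M) = μ(M)φ(3^k) + λ(M) + O(1)` (structure theorem up to finite modules;
`ℓ(Λ/(3^a,𝔮_k)) = aφ(3^k)`, `ℓ(Λ/(P,𝔮_k)) = deg P` for distinguished `P` once `φ(3^k) > deg P`) and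
`ℓ(R₀⟦T⟧/(𝔮_k,L)) = μ(L)φ(3^k) + λ(L)`; dividing by `φ(3^k) → ∞` gives `nμ(M) ≤ nμ(L) + 1` for all `n`. Degenerate
cases (`L = 0`; `𝔮_k ∣ L` or `𝔮_k ∣ Ch M` for the witnessing `k`) are consistent (`⊤` on the right). NOT a
divisibility statement: teeth read `(μ, λ)` only (lineage barrier B-g37-1 respected). Sibling of the tree's
`exists_card_quotSMulTop_qm_bounds` at Howard's primes. [Washington1997 §7.1 Prop. 7.2, §13.2 Thm. 13.12] -/
def ToothDominanceReadsMu : Prop :=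
  ∀ (M : Type) [AddCommGroup M] [Module (IwasawaAlgebra 3) M] [Module.Finite (IwasawaAlgebra 3) M],
    Module.IsTorsion (IwasawaAlgebra 3) M →
    ∀ (g L : UnrSeries 3),
      (Module.charIdeal (IwasawaAlgebra 3) M).map (PowerSeries.map (Halves.toUnr 3)) = Ideal.span {g} →
      (∀ n k₀ : ℕ, ∃ k : ℕ, k₀ ≤ k ∧
        (n : ℕ∞) * Module.length (IwasawaAlgebra 3) (ToothQuot M k) ≤
          (n : ℕ∞) * toothLengthOf L k + (Nat.totient (3 ^ k) : ℕ∞)) →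
      ∀ j : ℕ, (PowerSeries.C ((3 : ℕ) : unrIntegers 3)) ^ j ∣ g →
        (PowerSeries.C ((3 : ℕ) : unrIntegers 3)) ^ j ∣ L

/-- PIECE RT — THE ARITHMETIC LEAF (UNDECIDED; idea `relative-tooth-dominance`). RELATIVE TOOTH BOUND at additive
split 3: at every wall frame (binders = the wall's, verbatim), for every `n` and infinitely many teeth `𝔮_k`, the
`(∅,0)` Selmer specialisation `X/𝔮_k X` is finite and `n·ℓ_Λ(X/𝔮_k X) ≤ n·v_{π_k}(L(ζ_{3^k}-1)) + φ(3^k)`, i.e.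
`ℓ_{O_k}(X/𝔮_k X) ≤ v_{π_k}(L(ζ_{3^k}-1)) + o(φ(3^k))`. Informal engine (line card §Stubs RT1–RT3): a finite-level
Kolyvagin system over `O_k/π^j` from the trace-zero CM class of conductor `3^{k+c}` (lossless at deep teeth:
twisted Tamagawa lengths `O(3^{s(q)})`, Galois error `0`), the `(∅,0)`-vs-classical length identity in which the
global index CANCELS, the finite-order `p`-adic Waldspurger formula at the SAME character, and a LOCAL cancellation at
the additive prime between the resolvent valuation of the `χ_k`-generator of `Ĝ_a`-points and the conductor-`3^k`
local toric factor. No analytic `μ` theorem, no twin, no `Λ`-adic class. Why it might fail: the local cancellation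
RT3 may be off by `c·φ(3^k)` with `c > 0` on SCr rows (then only `μ(Ch X) ≤ μ(L) + c`). -/
def RelativeToothBoundAtThree : Prop :=
  ∀ (W : WeierstrassCurve ℚ) [W.IsElliptic] [W.IsGloballyMinimal] (N : ℕ) [NeZero N] (K : Type) [Field K]
    [NumberField K] (Dt : Literature.NumberTheory.EllipticCurves.ModularForms.ModularParametrizationData W N),
    Summit.BirchSwinnertonDyer.Rank1Residual.Additive.ClassO6 W 3 → W.HasSurjectiveModNGaloisRep 3 →
    W.analyticRank = 1 → W.conductorNorm ℤ = N → IsImaginaryQuadratic K → SatisfiesHeegnerHypothesis N K →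
    ∀ (κ : ZpExtension K 3), κ.IsAnticyclotomic →
    ∀ (γ : Field.absoluteGaloisGroup K) [Fact (κ.IsTopGenerator γ)]
      (𝔭 : IsDedekindDomain.HeightOneSpectrum (NumberField.RingOfIntegers K)),
      ((3 : ℕ) : NumberField.RingOfIntegers K) ∈ 𝔭.asIdeal →
      𝔭.asIdeal.ramificationIdx (NumberField.RingOfIntegers ℚ) = 1 →
      𝔭.asIdeal.inertiaDeg (NumberField.RingOfIntegers ℚ) = 1 →
      ∀ (𝔭' : IsDedekindDomain.HeightOneSpectrum (NumberField.RingOfIntegers K)),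
        ((3 : ℕ) : NumberField.RingOfIntegers K) ∈ 𝔭'.asIdeal → 𝔭' ≠ 𝔭 →
        ∀ (ι' : PadicAlgCl 3 ≃+* ℂ),
          Summit.BirchSwinnertonDyer.BirchSwinnertonDyer.Theorems.SchneiderFree.BranchInducesPrime 3 ι' 𝔭 →
          ∀ (ΩK : ℂ) (Ωp : ℂ_[3]) (L : UnrSeries 3), ΩK ≠ 0 → Ωp ≠ 0 →
            IsBDPLFunction ι' 𝔭 κ γ Dt.f ΩK Ωp L →
            ∀ n k₀ : ℕ, ∃ k : ℕ, k₀ ≤ k ∧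
              Finite (ToothQuot (AcSelmer.XAc (W.baseChange K) 3 κ 𝔭' ∅ γ) k) ∧
              (n : ℕ∞) * Module.length (IwasawaAlgebra 3) (ToothQuot (AcSelmer.XAc (W.baseChange K) 3 κ 𝔭' ∅ γ) k) ≤
                (n : ℕ∞) * toothLengthOf L k + (Nat.totient (3 ^ k) : ℕ∞)

/-! ## §3 Registered stubs (the ONLY `sorry`s) -/

/-- STUB (WEAKER — route item 24207 `RationalSplitIMCInclusionAtThree` BY NAME; `ratwall_of_wall`). -/
theorem stub_ratwall : RationalSplitIMCInclusionAtThree := by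
  sorry

/-- STUB (WEAKER — piece A, the wall's exact surplus over 24207; `muDominance_of_wall`; child = the teeth). -/
theorem stub_muDominance : MuDominanceAtThree := by
  sorry

/-- STUB (ATTACKABLE — piece c1, pure algebra). -/
theorem stub_isTorsionOfFiniteToothQuot : IsTorsionOfFiniteToothQuot := by
  sorry

/-- STUB (ATTACKABLE — piece d, pure algebra). -/
theorem stub_toothDominanceReadsMu : ToothDominanceReadsMu := by
  sorry

/-- STUB (UNDECIDED — piece RT, the arithmetic leaf). -/
theorem stub_relativeToothBound : RelativeToothBoundAtThree := by
  sorry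

/-! ## §4 LEVEL 1: WALL ↔ RATWALL ∧ μ-DOMINANCE (kernel-checked both ways) -/

/-- **The wall from the rational wall and `μ`-dominance** (concludes the crux BY NAME). At a frame: `3^k·L ∈ (g)`
(RATWALL), `g` a generator of `Ch·R₀⟦T⟧` (always exists), `μ`-dominance for this `g`; the §0 kernel gives
`(L) ⊆ (g)`. [folklore; Washington1997 §7.1] -/
theorem AdditiveSplitIMCInclusionAtThree_of :
    RationalSplitIMCInclusionAtThree → MuDominanceAtThree → AdditiveSplitIMCInclusionAtThree := by
  intro hR hM W _ _ N _ K _ _ Dt hO6 hsurj hr1 hN hK hH κ hκ γ _ 𝔭 h3 he hf 𝔭' h3' hne ι' hι ΩK Ωp L hΩK hΩp hL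
  obtain ⟨k, hk⟩ := hR W N K Dt hO6 hsurj hr1 hN hK hH κ hκ γ 𝔭 h3 he hf 𝔭' h3' hne ι' hι ΩK Ωp L hΩK hΩp hL
  obtain ⟨g, hg⟩ := exists_map_charIdeal_eq_span (AcSelmer.XAc (W.baseChange K) 3 κ 𝔭' ∅ γ)
  have hg' : (AcSelmer.XAc.charIdeal (W.baseChange K) 3 κ 𝔭' ∅ γ).map (PowerSeries.map (Halves.toUnr 3)) =
      Ideal.span {g} := hg
  have hμ := hM W N K Dt hO6 hsurj hr1 hN hK hH κ hκ γ 𝔭 h3 he hf 𝔭' h3' hne ι' hι ΩK Ωp L hΩK hΩp hL g hg'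
  rw [hg'] at hk ⊢
  have hdvd : g ∣ ((3 : ℕ) : UnrSeries 3) ^ k * L := Ideal.mem_span_singleton.mp hk
  rw [← map_natCast (PowerSeries.C (R := unrIntegers 3))] at hdvd
  exact span_le_span_of_dvd_pow_mul_of_muDominance hdvd hμ

/-- Tag WEAKER for piece A: THE WALL ⟹ `μ`-DOMINANCE (at a frame `(L) ⊆ Ch·R₀⟦T⟧ = (g)` gives `g ∣ L`). -/
theorem muDominance_of_wall : AdditiveSplitIMCInclusionAtThree → MuDominanceAtThree := by
  intro hW W _ _ N _ K _ _ Dt hO6 hsurj hr1 hN hK hH κ hκ γ _ 𝔭 h3 he hf 𝔭' h3' hne ι' hι ΩK Ωp L hΩK hΩp hL g hg j hj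
  have h := hW W N K Dt hO6 hsurj hr1 hN hK hH κ hκ γ 𝔭 h3 he hf 𝔭' h3' hne ι' hι ΩK Ωp L hΩK hΩp hL
  rw [hg] at h
  exact muDominance_of_span_le_span h j hj

/-- Tag WEAKER for RATWALL (landed, `k = 0`). -/
theorem ratwall_of_wall : AdditiveSplitIMCInclusionAtThree → RationalSplitIMCInclusionAtThree :=
  rationalSplitIMCInclusionAtThree_of_wall

/-- **THE EXACT COMPLEMENT**: THE WALL ↔ RATWALL ∧ `μ`-DOMINANCE. What the integral wall (20395) demands beyond the
rational wall (24207) is precisely `MuDominanceAtThree` — an inequality of `μ`-invariants, not a `μ = 0` theorem. -/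
theorem wall_iff_ratwall_and_muDominance :
    AdditiveSplitIMCInclusionAtThree ↔ (RationalSplitIMCInclusionAtThree ∧ MuDominanceAtThree) :=
  ⟨fun h ↦ ⟨ratwall_of_wall h, muDominance_of_wall h⟩, fun h ↦ AdditiveSplitIMCInclusionAtThree_of h.1 h.2⟩

/-! ## §5 LEVEL 2: the relative teeth give μ-dominance (composition kernel-checked) -/

/-- **`μ`-dominance from the relative tooth bound.** `X = X_(∅,0)(E/K_∞)` is finitely generated over `Λ` (LANDED,
`AcSelmer.XAc.module_finite`); one finite tooth specialisation makes it torsion (c1); the relative tooth inequalities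
(RT) feed the algebraic door (d). [Washington1997 §13.2] -/
theorem muDominanceAtThree_of_teeth :
    IsTorsionOfFiniteToothQuot → ToothDominanceReadsMu → RelativeToothBoundAtThree → MuDominanceAtThree := by
  intro h1 h2 h3 W _ _ N _ K _ _ Dt hO6 hsurj hr1 hN hK hH κ hκ γ _ 𝔭 hp3 he hf 𝔭' h3' hne ι' hι ΩK Ωp L hΩK hΩp hL
    g hg j hj
  haveI : Module.Finite (IwasawaAlgebra 3) (AcSelmer.XAc (W.baseChange K) 3 κ 𝔭' ∅ γ) :=
    AcSelmer.XAc.module_finite κ 𝔭' ∅ γ Set.finite_empty (W := W.baseChange K)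
  have hrel := h3 W N K Dt hO6 hsurj hr1 hN hK hH κ hκ γ 𝔭 hp3 he hf 𝔭' h3' hne ι' hι ΩK Ωp L hΩK hΩp hL
  obtain ⟨k, -, hfin, -⟩ := hrel 1 0
  have hT : Module.IsTorsion (IwasawaAlgebra 3) (AcSelmer.XAc (W.baseChange K) 3 κ 𝔭' ∅ γ) :=
    h1 (AcSelmer.XAc (W.baseChange K) 3 κ 𝔭' ∅ γ) ⟨k, hfin⟩
  have hg' : (Module.charIdeal (IwasawaAlgebra 3) (AcSelmer.XAc (W.baseChange K) 3 κ 𝔭' ∅ γ)).map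
      (PowerSeries.map (Halves.toUnr 3)) = Ideal.span {g} := hg
  refine h2 (AcSelmer.XAc (W.baseChange K) 3 κ 𝔭' ∅ γ) hT g L hg' ?_ j hj
  intro n k₀
  obtain ⟨k', hk', -, hle⟩ := hrel n k₀
  exact ⟨k', hk', hle⟩

/-- The two levels chained: THE WALL from RATWALL and the three tooth pieces. -/
theorem AdditiveSplitIMCInclusionAtThree_of_teeth :
    RationalSplitIMCInclusionAtThree → IsTorsionOfFiniteToothQuot → ToothDominanceReadsMu →
      RelativeToothBoundAtThree → AdditiveSplitIMCInclusionAtThree :=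
  fun hR h1 h2 h3 ↦ AdditiveSplitIMCInclusionAtThree_of hR (muDominanceAtThree_of_teeth h1 h2 h3)

end Summit.BirchSwinnertonDyer.BirchSwinnertonDyer.Cruxes.AdditiveSplitIMCInclusionAtThree.MuDominanceRelativeTeeth

end
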